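import Mathlib
import Summits.NavierStokesRegularity.NavierStokesRegularity.Theorems.EulerZoomLiouvillePowerGaugeEulerLiouvilleHelicityTubeStarvationFree
import Summits.NavierStokesRegularity.NavierStokesRegularity.Theorems.EulerZoomLiouvillePowerGaugeEulerLiouvilleHelicityTubeTubeTransportFree
import HarnessLib

/-!
# Crux `EulerZoomLiouville.PowerGaugeEulerLiouville` (stmt-NavierStokesRegularity-19832), line `helicity-tube` rev4:
# THE ZERO-HELICITY LAW, UNCONDITIONAL AND GRADIENT-FREE (T1′ ∘ T2′), and the emptiness of the stratum `IsHelicalTubePast`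

Route №10 `EulerZoomLiouville` (NavierStokesRegularity), crux E.  Line `helicity-tube` (ideator ns-idea-11 g4;
`Cruxes/PowerGaugeEulerLiouville/Lines/helicity_tube.lean` rev4 985d9ffb2a69).  With the GRADIENT-FREE stubs landed — T1′
`HelicityTube.tubesPersist_of_driftingPastWith_free` (…HelicityTubeTubeTransportFree: Moffatt's partial-helicity invariance via the cutoff-field flow and
the LOCAL Cauchy/Kelvin identities) and T2′ `HelicityTube.weightedHelicity_eq_zero_of_tubesPersist_free` (…HelicityTubeStarvationFree) — the line's
composition runs WITHOUT the rev1 clause «`∇u` bounded on compact time sets, uniformly in `x`» (compare ezl-w5 g0's `…HelicityTubeMember`, p629184,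
which carries it):

* `weightedHelicity_eq_zero_free` — **THE ZERO-HELICITY LAW, gradient-free**: for a member of the power-gauged class (`0 < ρ ≤ 1/2`) with a
  drifting classical far past `(T₁, M, κ)` (velocity envelope ONLY) of exponent `κ > (1−3ρ)/(2−3ρ)`, EVERY coherent vortex-tube datum of every slice
  `u(τ)`, `τ < T₁`, has zero weighted helicity;
* `false_of_helicalTubePast_free` — the rev4 stratum `IsHelicalTubePast ρ u p` (δ-unfolded, gradient-free) is EMPTY for members;
* `ae_eq_zero_of_gauge_of_helicalTubePast_free` — the member-level filler in the shape of the LEAD's strata (`InClass → IsHelicalTubePast ρ u p → u = 0` a.e.),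
  one name for `stub_helicalTubePast` WITHOUT the clause.

WHAT THIS IS NOT: not NS, not the crux — helpers `--supports` stmt-19832 about a hypothetical Euler zoom-limit class (one classical stratum is
empty); the residue T3 `stub_helicityRest` stays OPEN; no summit statement is proved here.  [cite: MajdaBertozziCUP2002, §1.6 Props. 1.10–1.12]
-/

noncomputable section

-- flat `Theorems/<Route><Decl>…` files of one crux share the namespace of the crux (tree convention)
set_option linter.dupNamespace false

open MeasureTheory Set Filter Topology Metric Function Real InnerProductSpace
open scoped NNReal ENNReal RealInnerProductSpace ContDiff

namespace Summit.NavierStokesRegularity.NavierStokesRegularity.Theorems.PowerGaugeEulerLiouville.HelicityTube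

open Literature.Analysis Literature.Analysis.FluidPDE

variable {u : ℝ → EuclideanSpace ℝ (Fin 3) → EuclideanSpace ℝ (Fin 3)} {p : ℝ → EuclideanSpace ℝ (Fin 3) → ℝ}
  {H : ℝ → EuclideanSpace ℝ (Fin 3) → EuclideanSpace ℝ (Fin 3) →L[ℝ] EuclideanSpace ℝ (Fin 3)} {c : ℝ≥0}

/-- **THE ZERO-HELICITY LAW, gradient-free** (unconditional: T1′ supplies the persistence T2′ consumes): for a member `(u,p,H,c)` of the power-gauged
class (`0 < ρ ≤ 1/2`) with a drifting classical far past `(T₁, M, κ)` of exponent `κ > (1−3ρ)/(2−3ρ)` — velocity envelope only, NO gradient hypothesis —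
every coherent vortex-tube datum `(χ, R)` of every slice `u(τ)`, `τ < T₁`, has zero weighted helicity `∫ χ ⟪u(τ), curl u(τ)⟫ = 0`.
[cite: MajdaBertozziCUP2002, §1.6 Props. 1.10–1.12] -/
theorem weightedHelicity_eq_zero_free {ρ : ℝ} (hρ : 0 < ρ) (hρ2 : ρ ≤ 1 / 2)
    (hsw : IsSuitableWeakSolutionOn (slab (EuclideanSpace ℝ (Fin 3)) (Set.Iio 0) isOpen_Iio) 0 0 u p)
    (hH : HasWeakSpatialGradientOn (slab (EuclideanSpace ℝ (Fin 3)) (Set.Iio 0) isOpen_Iio) u H)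
    (hgauge : ∀ a : ℝ, 0 < a →
      ENNReal.ofReal (a ^ (2 * ρ)) * cknA a (0 : ℝ × EuclideanSpace ℝ (Fin 3)) u +
          ENNReal.ofReal (a ^ ρ) * cknE a (0 : ℝ × EuclideanSpace ℝ (Fin 3)) H +
        ENNReal.ofReal (a ^ (2 * ρ)) * cknD a (0 : ℝ × EuclideanSpace ℝ (Fin 3)) p ≤ (c : ℝ≥0∞))
    {T₁ M κ : ℝ} (hcl : IsClassicalEulerSolutionOn (Set.Iio 0) 0 u p) (hT₁ : T₁ ≤ 0) (hM : 0 ≤ M) (hκ : κ < 1)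
    (henv : ∀ τ : ℝ, τ < T₁ → ∀ x : EuclideanSpace ℝ (Fin 3), ‖u τ x‖ ≤ M * (-τ) ^ (-κ))
    (hκρ : (1 - 3 * ρ) / (2 - 3 * ρ) < κ)
    {τ : ℝ} (hτ : τ < T₁) {χ : EuclideanSpace ℝ (Fin 3) → ℝ} {R : ℝ} (hR : 0 < R)
    (hχ : ContDiff ℝ ∞ χ ∧ (∀ x : EuclideanSpace ℝ (Fin 3), |χ x| ≤ 1) ∧
      (∀ x : EuclideanSpace ℝ (Fin 3), R ≤ ‖x‖ → χ x = 0) ∧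
      ∀ x : EuclideanSpace ℝ (Fin 3), fderiv ℝ χ x (curl (u τ) x) = 0) :
    ∫ x, χ x * ⟪u τ x, curl (u τ) x⟫ = 0 :=
  weightedHelicity_eq_zero_of_tubesPersist_free ρ hρ hρ2 u p H c ⟨hsw, hH, hgauge⟩ T₁ M κ
    ⟨hcl, hT₁, hM, hκ, henv⟩ hκρ
    (tubesPersist_of_driftingPastWith_free u p T₁ M κ ⟨hcl, hT₁, hM, hκ, henv⟩) τ hτ χ R hR hχ

/-- **The rev4 (gradient-free) stratum `IsHelicalTubePast` is EMPTY for members** (`δ`-unfolded): a member of the power-gauged class (`0 < ρ ≤ 1/2`)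
admits no drifting classical far past (velocity envelope only) of exponent `κ > (1−3ρ)/(2−3ρ)` carrying, at some time `τ < T₁`, a coherent vortex-tube
datum of NON-ZERO weighted helicity. [cite: MajdaBertozziCUP2002, §1.6 Prop. 1.12] -/
theorem false_of_helicalTubePast_free {ρ : ℝ} (hρ : 0 < ρ) (hρ2 : ρ ≤ 1 / 2)
    (hsw : IsSuitableWeakSolutionOn (slab (EuclideanSpace ℝ (Fin 3)) (Set.Iio 0) isOpen_Iio) 0 0 u p)
    (hH : HasWeakSpatialGradientOn (slab (EuclideanSpace ℝ (Fin 3)) (Set.Iio 0) isOpen_Iio) u H)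
    (hgauge : ∀ a : ℝ, 0 < a →
      ENNReal.ofReal (a ^ (2 * ρ)) * cknA a (0 : ℝ × EuclideanSpace ℝ (Fin 3)) u +
          ENNReal.ofReal (a ^ ρ) * cknE a (0 : ℝ × EuclideanSpace ℝ (Fin 3)) H +
        ENNReal.ofReal (a ^ (2 * ρ)) * cknD a (0 : ℝ × EuclideanSpace ℝ (Fin 3)) p ≤ (c : ℝ≥0∞))
    (hS : ∃ T₁ M κ : ℝ,
      (IsClassicalEulerSolutionOn (Set.Iio 0) 0 u p ∧ T₁ ≤ 0 ∧ 0 ≤ M ∧ κ < 1 ∧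
          (∀ τ : ℝ, τ < T₁ → ∀ x : EuclideanSpace ℝ (Fin 3), ‖u τ x‖ ≤ M * (-τ) ^ (-κ))) ∧
        (1 - 3 * ρ) / (2 - 3 * ρ) < κ ∧
        ∃ τ : ℝ, τ < T₁ ∧ ∃ (χ : EuclideanSpace ℝ (Fin 3) → ℝ) (R : ℝ), 0 < R ∧
          (ContDiff ℝ ∞ χ ∧ (∀ x : EuclideanSpace ℝ (Fin 3), |χ x| ≤ 1) ∧
              (∀ x : EuclideanSpace ℝ (Fin 3), R ≤ ‖x‖ → χ x = 0) ∧
              ∀ x : EuclideanSpace ℝ (Fin 3), fderiv ℝ χ x (curl (u τ) x) = 0) ∧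
            (∫ x, χ x * ⟪u τ x, curl (u τ) x⟫) ≠ 0) :
    False := by
  obtain ⟨T₁, M, κ, ⟨hcl, hT₁, hM, hκ, henv⟩, hκρ, τ, hτ, χ, R, hR, hχ, hne⟩ := hS
  exact hne (weightedHelicity_eq_zero_free hρ hρ2 hsw hH hgauge hcl hT₁ hM hκ henv hκρ hτ hR hχ)

/-- **Member-level filler in the shape of the skeleton's strata, gradient-free**: a member of the power-gauged class (`0 < ρ ≤ 1/2`) lying in the rev4
stratum `IsHelicalTubePast ρ u p` (`δ`-unfolded, NO gradient clause) vanishes a.e. on the past slab — vacuously (`false_of_helicalTubePast_free`).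
[cite: MajdaBertozziCUP2002, §1.6 Prop. 1.12] -/
theorem ae_eq_zero_of_gauge_of_helicalTubePast_free {ρ : ℝ} (hρ : 0 < ρ) (hρ2 : ρ ≤ 1 / 2)
    (hsw : IsSuitableWeakSolutionOn (slab (EuclideanSpace ℝ (Fin 3)) (Set.Iio 0) isOpen_Iio) 0 0 u p)
    (hH : HasWeakSpatialGradientOn (slab (EuclideanSpace ℝ (Fin 3)) (Set.Iio 0) isOpen_Iio) u H)
    (hgauge : ∀ a : ℝ, 0 < a →
      ENNReal.ofReal (a ^ (2 * ρ)) * cknA a (0 : ℝ × EuclideanSpace ℝ (Fin 3)) u +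
          ENNReal.ofReal (a ^ ρ) * cknE a (0 : ℝ × EuclideanSpace ℝ (Fin 3)) H +
        ENNReal.ofReal (a ^ (2 * ρ)) * cknD a (0 : ℝ × EuclideanSpace ℝ (Fin 3)) p ≤ (c : ℝ≥0∞))
    (hS : ∃ T₁ M κ : ℝ,
      (IsClassicalEulerSolutionOn (Set.Iio 0) 0 u p ∧ T₁ ≤ 0 ∧ 0 ≤ M ∧ κ < 1 ∧
          (∀ τ : ℝ, τ < T₁ → ∀ x : EuclideanSpace ℝ (Fin 3), ‖u τ x‖ ≤ M * (-τ) ^ (-κ))) ∧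
        (1 - 3 * ρ) / (2 - 3 * ρ) < κ ∧
        ∃ τ : ℝ, τ < T₁ ∧ ∃ (χ : EuclideanSpace ℝ (Fin 3) → ℝ) (R : ℝ), 0 < R ∧
          (ContDiff ℝ ∞ χ ∧ (∀ x : EuclideanSpace ℝ (Fin 3), |χ x| ≤ 1) ∧
              (∀ x : EuclideanSpace ℝ (Fin 3), R ≤ ‖x‖ → χ x = 0) ∧
              ∀ x : EuclideanSpace ℝ (Fin 3), fderiv ℝ χ x (curl (u τ) x) = 0) ∧
            (∫ x, χ x * ⟪u τ x, curl (u τ) x⟫) ≠ 0) :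
    uncurry u =ᵐ[volume.restrict (Set.Iio (0 : ℝ) ×ˢ (Set.univ : Set (EuclideanSpace ℝ (Fin 3))))] 0 :=
  (false_of_helicalTubePast_free hρ hρ2 hsw hH hgauge hS).elim

end Summit.NavierStokesRegularity.NavierStokesRegularity.Theorems.PowerGaugeEulerLiouville.HelicityTube

end
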